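import Literature.NumberTheory.LFunctions.YoshidaWindowGramTailJFactored
import HarnessLib

/-!
# Kernel enclosures of Yoshida's matrix coefficients — VII-e: the factored order-`J` tails, RESCALED to unit size

Source: H. Yoshida, Adv. Stud. Pure Math. **21** (1992) 281–325, §§5–7 [Yoshida1992HermitianForms]; R. E. Moore,
*Interval Analysis* (1966), Ch. 3 [Moore1966] (inclusion property).

Part VII-d factors the order-`J` tails as `U₂(i,i') = Σ_{r<2J} φ_r(i)ψ_r(i') + [i=i']dg(i)` with `φ_r(i) ∼ i^{2r}` (up to
`B^{2J}`) and `ψ_r(i') ∼ B₃^{−2r−1}`: fixed-point DATA of such factors (the column-band kit certifies the factors as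
packed integers at one absolute unit per family) would need ~`2J·log₂B` guard bits.  Rescaling by `λ_r = B^{p(r)}`
(`p(r) = 2r` on the A-family, `2(r−J)+1` on the B-family; odd: `2r+1`, `2(r−J)`) makes both factors `O(1)`:

* `Encl.phiJeS = φ_r(i)/B^{p(r)}`, `Encl.psiJeS = ψ_r(i')·B^{p(r)}`, `Encl.U2EvenJ_eq_factoredS` (same sum, `B > 0`);
  boxes `phiJeSBox = phiJeBox/B^{p}` (`divNat`), `psiJeSBox = psiJeBox·B^{p}` (`mulInt`) with `mem` lemmas;
* the odd analogues `phiJoS`, `psiJoS`, `U2OddJ_eq_factoredS`, `phiJoSBox`, `psiJoSBox`.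

Everything is proved; no named facts.
-/

open Real Complex Finset Matrix
open scoped BigOperators

namespace Literature.NumberTheory.LFunctions.Yoshida1992

open Literature.Analysis.SpecialFunctions Literature.Analysis.ValidatedNumerics.NumericsMP
open Literature.Analysis.ValidatedNumerics

namespace Encl

variable {S : ℕ} {a : ℝ} {ks : List PrimeLen} {C : Consts}

/-! ## Even sector -/

/-- Scaling exponent: `2r` (A-family, `r < J`), `2(r−J)+1` (B-family). [cite: Yoshida1992HermitianForms, §7 pp. 305–312] -/
def pJe (Je r : ℕ) : ℕ := if r < Je then 2 * r else 2 * (r - Je) + 1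

/-- `φ⁺_r(i)/B^{p(r)}`. [cite: Yoshida1992HermitianForms, §7 pp. 305–312] -/
noncomputable def phiJeS (a : ℝ) (Be Je i r : ℕ) : ℝ := phiJe a Je i r / (Be : ℝ) ^ pJe Je r

/-- `ψ⁺_r(i')·B^{p(r)}`. [cite: Yoshida1992HermitianForms, §7 pp. 305–312] -/
noncomputable def psiJeS (a θ η d0 : ℝ) (Be B3e Je i' r : ℕ) : ℝ := psiJe a θ η d0 Be B3e Je i' r * (Be : ℝ) ^ pJe Je r

/-- **`U₂⁺ = Σ_{r<2J} (φ_r/λ_r)(ψ_r λ_r)ᵀ + diag`** (`B > 0`). [cite: Yoshida1992HermitianForms, §7 pp. 305–312] -/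
theorem U2EvenJ_eq_factoredS (a θ η d0 : ℝ) {Be : ℕ} (hBe : 0 < Be) (B3e Je i i' : ℕ) :
    U2EvenJ a θ η d0 Be B3e Je i i'
      = (∑ r ∈ Finset.range (Je + Je), phiJeS a Be Je i r * psiJeS a θ η d0 Be B3e Je i' r)
        + (if i = i' then dgJe a θ d0 Be B3e Je i else 0) := by
  rw [U2EvenJ_eq_factored]
  congr 1
  refine Finset.sum_congr rfl fun r _ ↦ ?_
  unfold phiJeS psiJeS
  have hB : ((Be : ℝ)) ^ pJe Je r ≠ 0 := pow_ne_zero _ (by exact_mod_cast hBe.ne')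
  field_simp

/-- Box of `φ⁺_r(i)/B^{p(r)}`. [cite: Moore1966, Ch. 3 (interval arithmetic: inclusion property)] -/
def phiJeSBox (S : ℕ) (C : Consts) (F : FDConsts) (R : IdxRec) (Be Je i r : ℕ) : MI :=
  (phiJeBox S C F R Je i r).divNat (Be ^ pJe Je r)

/-- [cite: Moore1966, Ch. 3 (interval arithmetic: inclusion property)] -/
theorem mem_phiJeSBox (hS : 0 < S) (hks : PrimeData a ks) (hC : ConstsValid S a ks C) {F : FDConsts}
    (hF : FDValid S a F) {Be i r Je : ℕ} (hBe : 0 < Be) {R : IdxRec} (hR : OffValid S a ks (i : ℤ) R) :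
    MI.mem S (phiJeS a Be Je i r) (phiJeSBox S C F R Be Je i r) := by
  unfold phiJeS phiJeSBox
  have h := MI.mem_divNat (mem_phiJeBox hS hks hC hF (Je := Je) (r := r) hR) (n := Be ^ pJe Je r) (by positivity)
  refine mem_of_eq h ?_
  push_cast; rfl

/-- Box of `ψ⁺_r(i')·B^{p(r)}`. [cite: Moore1966, Ch. 3 (interval arithmetic: inclusion property)] -/
def psiJeSBox (S : ℕ) (C : Consts) (F : FDConsts) (R : IdxRec) (cd d0z Be B3e Je θn θd ηn ηd : ℕ) (i' r : ℕ) : MI :=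
  (psiJeBox S C F R cd d0z Be B3e Je θn θd ηn ηd i' r).mulInt ((Be : ℤ) ^ pJe Je r)

/-- [cite: Moore1966, Ch. 3 (interval arithmetic: inclusion property)] -/
theorem mem_psiJeSBox (hS : 0 < S) (hks : PrimeData a ks) (hC : ConstsValid S a ks C) {F : FDConsts}
    (hF : FDValid S a F) {cd d0z Be B3e Je θn θd ηn ηd : ℕ} (hd0 : 0 < d0z) (hθn : 0 < θn) (hθd : 0 < θd)
    (hηn : 0 < ηn) (hηd : 0 < ηd) (hBe : 0 < Be) (hB3 : 2 ≤ B3e) {i' r : ℕ} {R : IdxRec}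
    (hR : OffValid S a ks (i' : ℤ) R) :
    MI.mem S (psiJeS a ((θn : ℝ) / θd) ((ηn : ℝ) / ηd) ((d0z : ℝ) * (1 / 2 ^ cd)) Be B3e Je i' r)
      (psiJeSBox S C F R cd d0z Be B3e Je θn θd ηn ηd i' r) := by
  unfold psiJeS psiJeSBox
  have h := MI.mem_mulInt (mem_psiJeBox hS hks hC hF (cd := cd) hd0 hθn hθd hηn hηd hBe hB3 (Je := Je) (r := r) hR)
    ((Be : ℤ) ^ pJe Je r)
  refine mem_of_eq h ?_
  push_cast; rfl

/-! ## Odd sector -/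

/-- Scaling exponent (odd): `2r+1` (A-family), `2(r−J)` (B-family). [cite: Yoshida1992HermitianForms, §7 pp. 305–312] -/
def pJo (Jo r : ℕ) : ℕ := if r < Jo then 2 * r + 1 else 2 * (r - Jo)

/-- `φ⁻_r(k)/B^{p(r)}`. [cite: Yoshida1992HermitianForms, §7 pp. 305–312] -/
noncomputable def phiJoS (a : ℝ) (Bo Jo k r : ℕ) : ℝ := phiJo a Jo k r / (Bo : ℝ) ^ pJo Jo r

/-- `ψ⁻_r(k')·B^{p(r)}`. [cite: Yoshida1992HermitianForms, §7 pp. 305–312] -/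
noncomputable def psiJoS (a θ η d0 : ℝ) (Bo B3o Jo k' r : ℕ) : ℝ := psiJo a θ η d0 Bo B3o Jo k' r * (Bo : ℝ) ^ pJo Jo r

/-- **`U₂⁻ = Σ_{r<2J} (φ_r/λ_r)(ψ_r λ_r)ᵀ + diag`** (`B > 0`). [cite: Yoshida1992HermitianForms, §7 pp. 305–312] -/
theorem U2OddJ_eq_factoredS (a θ η d0 : ℝ) {Bo : ℕ} (hBo : 0 < Bo) (B3o Jo k k' : ℕ) :
    U2OddJ a θ η d0 Bo B3o Jo k k'
      = (∑ r ∈ Finset.range (Jo + Jo), phiJoS a Bo Jo k r * psiJoS a θ η d0 Bo B3o Jo k' r)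
        + (if k = k' then dgJo a θ d0 Bo B3o Jo k else 0) := by
  rw [U2OddJ_eq_factored]
  congr 1
  refine Finset.sum_congr rfl fun r _ ↦ ?_
  unfold phiJoS psiJoS
  have hB : ((Bo : ℝ)) ^ pJo Jo r ≠ 0 := pow_ne_zero _ (by exact_mod_cast hBo.ne')
  field_simp

/-- Box of `φ⁻_r(k)/B^{p(r)}`. [cite: Moore1966, Ch. 3 (interval arithmetic: inclusion property)] -/
def phiJoSBox (S : ℕ) (C : Consts) (F : FDConsts) (R : IdxRec) (Bo Jo k r : ℕ) : MI :=
  (phiJoBox S C F R Jo k r).divNat (Bo ^ pJo Jo r)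

/-- [cite: Moore1966, Ch. 3 (interval arithmetic: inclusion property)] -/
theorem mem_phiJoSBox (hS : 0 < S) (hks : PrimeData a ks) (hC : ConstsValid S a ks C) {F : FDConsts}
    (hF : FDValid S a F) {Bo k r Jo : ℕ} (hBo : 0 < Bo) {R : IdxRec} (hR : OffValid S a ks ((k : ℤ) + 1) R) :
    MI.mem S (phiJoS a Bo Jo k r) (phiJoSBox S C F R Bo Jo k r) := by
  unfold phiJoS phiJoSBox
  have h := MI.mem_divNat (mem_phiJoBox hS hks hC hF (Jo := Jo) (r := r) hR) (n := Bo ^ pJo Jo r) (by positivity)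
  refine mem_of_eq h ?_
  push_cast; rfl

/-- Box of `ψ⁻_r(k')·B^{p(r)}`. [cite: Moore1966, Ch. 3 (interval arithmetic: inclusion property)] -/
def psiJoSBox (S : ℕ) (C : Consts) (F : FDConsts) (R : IdxRec) (cd d0z Bo B3o Jo θn θd ηn ηd : ℕ) (k' r : ℕ) : MI :=
  (psiJoBox S C F R cd d0z Bo B3o Jo θn θd ηn ηd k' r).mulInt ((Bo : ℤ) ^ pJo Jo r)

/-- [cite: Moore1966, Ch. 3 (interval arithmetic: inclusion property)] -/
theorem mem_psiJoSBox (hS : 0 < S) (hks : PrimeData a ks) (hC : ConstsValid S a ks C) {F : FDConsts}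
    (hF : FDValid S a F) {cd d0z Bo B3o Jo θn θd ηn ηd : ℕ} (hd0 : 0 < d0z) (hθn : 0 < θn) (hθd : 0 < θd)
    (hηn : 0 < ηn) (hηd : 0 < ηd) (hBo : 0 < Bo) (hB3 : 1 ≤ B3o) {k' r : ℕ} {R : IdxRec}
    (hR : OffValid S a ks ((k' : ℤ) + 1) R) :
    MI.mem S (psiJoS a ((θn : ℝ) / θd) ((ηn : ℝ) / ηd) ((d0z : ℝ) * (1 / 2 ^ cd)) Bo B3o Jo k' r)
      (psiJoSBox S C F R cd d0z Bo B3o Jo θn θd ηn ηd k' r) := by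
  unfold psiJoS psiJoSBox
  have h := MI.mem_mulInt (mem_psiJoBox hS hks hC hF (cd := cd) hd0 hθn hθd hηn hηd hBo hB3 (Jo := Jo) (r := r) hR)
    ((Bo : ℤ) ^ pJo Jo r)
  refine mem_of_eq h ?_
  push_cast; rfl

end Encl

end Literature.NumberTheory.LFunctions.Yoshida1992
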